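import Literature.Analysis.FluidPDE.SereginSverakOffAxisEpsilon
import Literature.Analysis.FluidPDE.SereginSverakOffAxisInputsProofs
import Literature.Analysis.FluidPDE.SereginSverakOffAxisAssembly
import Literature.Analysis.FluidPDE.SereginSverakScaledEnergyHolds
import Literature.Analysis.FluidPDE.PressureDecayEstimateProofs
import Literature.Analysis.FluidPDE.CKNEpsilonRegularityHolds
import Literature.Analysis.FluidPDE.SereginZajaczkowski2007L42OffAxisHolds
import Literature.Analysis.FluidPDE.SereginZajaczkowski2007L42Kinematic
import Literature.Analysis.FluidPDE.SereginZajaczkowski2007SwirlProofs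
import Literature.Analysis.FluidPDE.NSBoundedHigherRegularityQuant
import HarnessLib

/-!
# Seregin–Šverák 2009, Proposition 3.7 (`AxisDecayBound`): the discharge frontier, assembled

Proofs-only glue file (no definitions, no named facts) for the named fact
`SereginSverak2009.AxisDecayBound` (`SereginSverakAxisymmetric.lean`; G. Seregin, V. Šverák, *On
Type I singularities of the local axi-symmetric solutions of the Navier–Stokes equations*, Comm.
PDE 34 (2009) 171–201 = arXiv:0804.1803, Prop. 3.7, p. 10: under the conditions of Thm. 3.1,
`|v(x,t)| ≤ C₁/|x'|` on `Q(1/8)`). Its printed proof (p. 10) has two inputs, Lemma 3.5 and the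
off-axis bound (as15) "shown in [S11]" = Seregin–Zajaczkowski 2007, Prop. 4.1, and both the proof
and the proof of [S11] are formalised in the tree as accepted reductions:

* the covering `axisDecayBound_of_offAxisBound` (`SereginSverakAxisymmetricProofs.lean`), the
  inverse scaling `offAxisBound_of_unitScaleOffAxisBound` (`SereginSverakOffAxisScaling.lean`) and
  the unit-scale assembly `unitScaleOffAxisBound_of_inputs : OffAxisL6Bound →
  OffAxisSmoothRepresentative → seregin_sverak_pressure_decay → lemarieRieusset_epsilon_regularity →
  UnitScaleOffAxisBound` (`SereginSverakOffAxisEpsilon.lean`);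
* Lemma 3.5 is a theorem (`ScaledEnergyBound_holds`), as are the pressure decay estimate
  (`seregin_sverak_pressure_decay_holds`) and the ε-regularity criterion
  (`lemarieRieusset_epsilon_regularity_holds`);
* Seregin–Zajaczkowski 2007, Cor. 4.4 (`OffAxisL6Bound`) is reduced to Lemma 4.2
  (`OffAxisPoloidalBound`) and Lemma 4.3 (`OffAxisSwirlL6Bound`) by `offAxisL6Bound_of`
  (`SereginZajaczkowski2007L6.lean`); Lemma 4.2 to its two halves by `offAxisPoloidalBound_of`
  (`SereginZajaczkowski2007L42.lean`), both of which are theorems (`OffAxisVorticityL2Bound_holds`,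
  `PoloidalLqOfVorticityL2_holds`); Lemma 4.3 to the `L⁴`-energy bound (4.18) by
  `offAxisSwirlL6Bound_of_swirlL4EnergyBound` (`SereginZajaczkowski2007SwirlProofs.lean`);
* the off-axis smoothness of the pairs (`OffAxisSmoothRepresentative`) is reduced to the higher
  interior regularity of bounded solutions by `offAxisSmoothRepresentative_of_higherRegularity`
  (`SereginSverakOffAxisInputsProofs.lean`).

This file composes these pieces. It PROVES Seregin–Zajaczkowski 2007, Lemma 4.2
(`OffAxisPoloidalBound_holds`, a discharge) and records the exact remaining trust base of
Prop. 3.7 as checked terms: `AxisDecayBound` (and on the way `OffAxisL6Bound`,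
`UnitScaleOffAxisBound`, `OffAxisBound`) follows from the TWO named facts of the tree that are not
yet theorems on this path —

* `SereginZajaczkowski2007.SwirlL4EnergyBound` (Seregin–Zajaczkowski 2007, (4.18): the
  `L⁴`-energy bound for `|ϱ V_φ ψ|²`, `SereginZajaczkowski2007Swirl.lean`), and
* `NSBoundedHigherRegularity` (Seregin–Šverák 2009, §2 p. 8: higher interior regularity of
  essentially bounded distributional solutions, `NSBoundedHigherRegularity.lean`; implied by its
  quantitative form `NSBoundedHigherRegularityBounds` and by `seregin2014_lemma61`) —

so that `AxisDecayBound_holds` is the term `axisDecayBound_of_leaves SwirlL4EnergyBound_holds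
NSBoundedHigherRegularity_holds` once those two discharges exist (variants for the quantitative
form and for Seregin 2014, Lemma 6.1 are given). Nothing new is asserted.

## References

* G. Seregin, V. Šverák, Comm. PDE 34 (2009) 171–201, arXiv:0804.1803: Lemma 3.5 (p. 9),
  Prop. 3.7 and its proof, (as14)–(as15) (p. 10), §2 p. 8. [`SereginSverak2009`]
* G. Seregin, W. Zajaczkowski, SIAM J. Math. Anal. 39 (2007) 669–685, arXiv:math/0702720: Prop. 4.1,
  Lemmas 4.2–4.3, Cor. 4.4, (4.18). [`SereginZajaczkowski2007`]
-/

noncomputable section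

namespace Literature.Analysis.FluidPDE

namespace SereginZajaczkowski2007

/-- **Seregin–Zajaczkowski 2007, Lemma 4.2, proved** (the named statement `OffAxisPoloidalBound`:
`sup_{-(7/4)² < t < 0} ∫_{𝒞̃₁} |V^a|^q dx ≤ Φ₁(q, 𝒜₂)` for the smooth axially symmetric class on
`Q̃`), by the accepted reduction `offAxisPoloidalBound_of` ("Now, (4.2) immediately follows") fed
with its two discharged halves `OffAxisVorticityL2Bound_holds` ((4.5)–(4.13)) and
`PoloidalLqOfVorticityL2_holds` ((4.3)–(4.7) and the two-dimensional Sobolev inequality).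
[cite: SereginZajaczkowski2007, Lemma 4.2 ((4.2))] -/
theorem OffAxisPoloidalBound_holds : OffAxisPoloidalBound :=
  offAxisPoloidalBound_of OffAxisVorticityL2Bound_holds PoloidalLqOfVorticityL2_holds

/-- **Seregin–Zajaczkowski 2007, Corollary 4.4 from (4.18) alone**: with Lemma 4.2 proved, the
`L₆` bound `OffAxisL6Bound` follows from the `L⁴`-energy bound (4.18) for the cut-off swirl
(`SwirlL4EnergyBound`) through Lemma 4.3 (`offAxisSwirlL6Bound_of_swirlL4EnergyBound`) and
"From Lemmata 4.2 and 4.3" (`offAxisL6Bound_of`). [cite: SereginZajaczkowski2007, Cor. 4.4 ((4.19))] -/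
theorem offAxisL6Bound_of_swirlL4EnergyBound (h418 : SwirlL4EnergyBound) : OffAxisL6Bound :=
  offAxisL6Bound_of OffAxisPoloidalBound_holds (offAxisSwirlL6Bound_of_swirlL4EnergyBound h418)

end SereginZajaczkowski2007

namespace SereginSverak2009

open SereginZajaczkowski2007

/-- **Seregin–Šverák 2009, (as15) (`UnitScaleOffAxisBound`) from the two remaining leaves**:
Seregin–Zajaczkowski 2007, (4.18) (`SwirlL4EnergyBound`, giving Cor. 4.4 by
`offAxisL6Bound_of_swirlL4EnergyBound`) and the higher interior regularity of bounded solutions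
(`NSBoundedHigherRegularity`, giving the off-axis smoothness of the pairs by
`offAxisSmoothRepresentative_of_higherRegularity`), the other two inputs of
`unitScaleOffAxisBound_of_inputs` being the theorems `seregin_sverak_pressure_decay_holds` and
`lemarieRieusset_epsilon_regularity_holds`.
[cite: SereginSverak2009, proof of Prop. 3.7, (as15) (arXiv p. 10)] -/
theorem unitScaleOffAxisBound_of_leaves (h418 : SwirlL4EnergyBound)
    (hH : NSBoundedHigherRegularity) : UnitScaleOffAxisBound :=
  unitScaleOffAxisBound_of_inputs (offAxisL6Bound_of_swirlL4EnergyBound h418)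
    (offAxisSmoothRepresentative_of_higherRegularity hH) seregin_sverak_pressure_decay_holds
    lemarieRieusset_epsilon_regularity_holds

/-- **Seregin–Šverák 2009, (as14) (`OffAxisBound`, the display after (as15)) from the two remaining
leaves**, through the accepted inverse scaling `offAxisBound_of_unitScaleOffAxisBound`.
[cite: SereginSverak2009, proof of Prop. 3.7, (as14)–(as15) (arXiv p. 10)] -/
theorem offAxisBound_of_leaves (h418 : SwirlL4EnergyBound) (hH : NSBoundedHigherRegularity) :
    OffAxisBound :=
  offAxisBound_of_unitScaleOffAxisBound (unitScaleOffAxisBound_of_leaves h418 hH)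

/-- **Seregin–Šverák 2009, Proposition 3.7 (`AxisDecayBound`) from the two remaining leaves**:
Lemma 3.5 is the theorem `ScaledEnergyBound_holds`, (as15) is `unitScaleOffAxisBound_of_leaves`,
and "It remains to apply Lemma 3.5" is the accepted covering
`axisDecayBound_of_unitScaleOffAxisBound`. The unconditional `AxisDecayBound_holds` is this
theorem applied to `SwirlL4EnergyBound_holds` and `NSBoundedHigherRegularity_holds` once they
exist. [cite: SereginSverak2009, Prop. 3.7 and its proof (arXiv p. 10)] -/
theorem axisDecayBound_of_leaves (h418 : SwirlL4EnergyBound) (hH : NSBoundedHigherRegularity) :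
    AxisDecayBound :=
  axisDecayBound_of_unitScaleOffAxisBound ScaledEnergyBound_holds
    (unitScaleOffAxisBound_of_leaves h418 hH)

/-- **Proposition 3.7 from (4.18) and the quantitative higher regularity**
(`NSBoundedHigherRegularityBounds`, Seregin–Šverák 2009, §2 p. 8 with the printed dependence of
the norms, which implies the qualitative `NSBoundedHigherRegularity`).
[cite: SereginSverak2009, Prop. 3.7 and §2 p. 8] -/
theorem axisDecayBound_of_leaves_of_bounds (h418 : SwirlL4EnergyBound)
    (hB : NSBoundedHigherRegularityBounds) : AxisDecayBound :=
  axisDecayBound_of_leaves h418 hB.nsBoundedHigherRegularity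

/-- **Proposition 3.7 from (4.18) and Seregin 2014, Lemma 6.1** (`seregin2014_lemma61`, the
ε-regularity lemma with all derivatives), through the accepted `axisDecayBound_of_lemma61`
(`SereginSverakOffAxisAssembly.lean`) with its Cor. 4.4 input reduced to (4.18).
[cite: SereginSverak2009, Prop. 3.7 and its proof (arXiv p. 10)] -/
theorem axisDecayBound_of_swirlL4EnergyBound_of_lemma61 (h418 : SwirlL4EnergyBound)
    (h61 : seregin2014_lemma61) : AxisDecayBound :=
  axisDecayBound_of_lemma61 ScaledEnergyBound_holds (offAxisL6Bound_of_swirlL4EnergyBound h418) h61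

end SereginSverak2009

end Literature.Analysis.FluidPDE

end
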